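import Summits.QuantumFields.YangMills.Theorems.IR.AfPincerUcTypChainTorusAnchor
import HarnessLib

/-!
# Crux `IR` (stmt-QuantumFields-19354), line `af-pincer-Uc`: the lane-A supplier statement for `TypChain` REDUCED BY NAME —
# clause (iii) DISCHARGED (torus anchor, chessboard), clause (ii) NAMED as kernel plaquette-set sparseness (LEAD ym-lead-19354-af-pincer g3)

Helper module for item `stmt-QuantumFields-19354` (`--supports stmt-QuantumFields-19354 --as helper`; it closes nothing).  Slot of record
«sharp merge I♯_SC» (`Cruxes/IR/Lines/af_pincer_Uc_sharp.lean`, sha16 `28967a1bf60ad397`): open stub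
`stub_onsetSharpSC : AfPincerUc.SharpOnset.OnsetSharpUKPcSC`; lane-A supplier statement of record `TypChainSharpSC` (p539933, owner R112):
per mesh-`b` frame, (i) `ClauseIAll`, (ii) `ClauseIIukp`, (iii) `ClauseIII` for the short-chain class `TypChain r.ρ θ w ℓ₀`.

INTEGRATION (LEAD duty L4) of the chain-Peierls files of seat ym-19354-afpincer-s1 g2:
`AfPincerUcTypChainPeierls` (p540903: abstract hereditary Peierls bound; (ii) ⟸ kernel sparseness `clauseIIukp_typChain_of_kernelSparse`) and
`AfPincerUcTypChainTorusAnchor` (`clauseIII_typChain`: (iii) PROVED for `TypChain` from the route's odd-torus chessboard estimate).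

* §1 `KernelPlaqSparse ρ β w θ ℓ₀ q` — the (ii)-side research content NAMED, verbatim the hypothesis `hsp` of
  `clauseIIukp_typChain_of_kernelSparse`: under every DLR kernel `γ_{regionEdges w F'}(ζ)` whose exterior `ζ` meets the format's guard
  (each cell within sup-distance `1` of a charged cell is resampled or `TypChain`-typical), every set `X` of plaquettes of the charged cells is
  simultaneously `θ`-bad with probability `≤ q ^ #X`.  `clauseIIukp_typChain_of_kernelPlaqSparse` (S1's reduction, by name).
* §2 `halfExtent κ C = ⌈4 C⁺/κ⌉₊`, `extentOf θ κ C = 2 · max (halfExtent (θ/12) C) (halfExtent κ C)` and `budget_of_halfExtent` /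
  `budget_of_extent` — the Peierls budget arithmetic ONCE, for any rate `κ > 0` and mesh growth `C`, MONOTONE in the extent: every extent
  `ℓ₀ ≥ 2 · halfExtent κ C`, every `δ > 0` and prefactor `B` admit `β₂` beyond which `q = e^{−κβ}` satisfies `3750 q ≤ 1/2` and
  `192 b⁴ q (3750 q)^{⌈ℓ₀/2⌉} ≤ δ` for all meshes `b ≤ B e^{Cβ}`.
* §3 **`TypChainReducedSC`** — the REDUCED lane-A supplier target: for every SC `(G, r, a)` with `LowerBounds`: admissible `(n, ε)`, a threshold
  `θ > 0`, a kernel rate `κ > 0` and a mesh growth `C`, such that FOR EVERY tolerated extent `ℓ₀` and every `δ > 0` there are `T, B, β₂` with: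
  for all `β ≥ β₂` SOME mesh `b ≥ 1`, `a β · b < T`, `b ≤ B e^{Cβ}`, carries on every mesh-`b` frame clause (i) at every centre for
  `TypChain r.ρ θ w ℓ₀` AND `KernelPlaqSparse r.ρ β w θ ℓ₀ e^{−κβ}`.  No clause (iii); clause (ii) in chessboard shape.
  `TypChainReducedAtSC` — the same asked ONLY at the single explicit extent `ℓ₀ = extentOf θ κ C` (the exact demand;
  `typChainReducedAtSC_of_reduced`).  `clauses_typChain_extentOf` (per-`(G, r)` engine: at `extentOf`, kernel sparseness ⇒ (ii) and the
  torus anchor ⇒ (iii), budget `δ`, meshes `b ≤ B e^{Cβ}`), **`typChainSharpSC_of_reducedAt : TypChainReducedAtSC → TypChainSharpSC`**,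
  `typChainSharpSC_of_reduced`, `onsetSharpUKPcSC_of_typChainReduced{At,}SC` (⇒ I♯_SC), `ir_of_typChainReduced{At,}SC` (∧ `IRNSC` ⇒ `IR` BY NAME).

WHY `∀ ℓ₀` (β₂ after ℓ₀): `TypChain θ ℓ₀` grows with `ℓ₀`, so (i) is monotonically HARDER and (ii)/(iii) easier in `ℓ₀`; the torus anchor and the
kernel budget need `ℓ₀ ≥ 2⌈48C⁺/θ⌉₊` resp. `2⌈4C⁺/κ⌉₊` (R109 (4) quantified), an `O(1)` extent against a mesh `b(β) → ∞`;
`TypChainReducedAtSC` is the exact single-extent demand for a supplier who cannot afford every `ℓ₀`.  The mesh-growth conjunct `b ≤ B e^{Cβ}` is the supplier's CHOICE (at the sharp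
mesh `b < T(δ)/a(β)` it is automatic for units with an exponential floor `a(β) ≥ A₀ e^{−Cβ}`, asymptotically free units included; for faster units
the supplier takes `b = min(…)` — (i) is then asked at a mesh below `1/a`, which is where it is physically available anyway once `e^{Cβ} ≫ ξ(β)`).

LOCATED CONTENT after this file (what `stub_onsetSharpSC` reduces to BY NAME on lane A): (i) `ClauseIAll … (TypChain r.ρ θ w ℓ₀)` at a mesh
`≍ min(1/a, e^{Cβ})` = weak-coupling mixing for collars carrying sparse short bad chains (R107 (c), the crux content) AND (ii′) `KernelPlaqSparse`
= large-field sparseness of THIN plaquette sets under DLR kernels UNIFORMLY in the guarded exterior.  LEAD's reading of (ii′) [heur]: it is NOT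
soft — reflection positivity (chessboard) is unavailable for kernels with a fixed exterior, and the only model-independent transfer (comparison of
boundary conditions, or `IRKernelLargeField.kernel_measureReal_le_actionIn_le_of_subset`) costs `O(β N · #∂)`, which dominates `θ β · #X` for thin
`X`; a proof needs LOCALITY of the exterior's influence on deep large-field events at weak coupling (boundary-layer large deviations), i.e. the
same tier of machinery as (i).  So the honest net of the chain-Peierls row is: (iii) closed, (ii) relocated next to (i).

HONEST FRAMING: by-name bookkeeping and one arithmetic lemma around ONE open stub of a CONDITIONAL chain (Track A 0/28 UV); nothing of
weak-coupling mixing, asymptotic freedom or a gap is proved or claimed; not infinite volume, not Clay.  No `sorry`; axioms ⊆ {propext,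
Classical.choice, Quot.sound}.
-/

set_option autoImplicit false

noncomputable section

open Filter Topology MeasureTheory
open Literature.MathematicalPhysics.QuantumFieldTheory hiding ZdEdge
open Literature.MathematicalPhysics.QuantumLattice
open Summit.QuantumFields.YangMills.Cruxes.OSLegsFromFemtoAndGap.DlrCollarTransfer (LowerBounds)
open Summit.QuantumFields.YangMills.Cruxes.IR.Tempered (regionEdges)
open Summit.QuantumFields.YangMills.Theorems.OddTorusChessboard (cellPlaqs plaqAction)

namespace Summit.QuantumFields.YangMills.Cruxes.IR.AfPincerUc.SharpLanes

open Summit.QuantumFields.YangMills.Cruxes.IR.AfPincerUc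

/-! ## §1 The (ii)-side content NAMED: kernel plaquette-set sparseness under the guarded DLR kernels -/
section KernelSparse

variable {G : Type} [Group G] [TopologicalSpace G] [IsTopologicalGroup G] [CompactSpace G]
  [MeasurableSpace G] [BorelSpace G]

/-- **Kernel plaquette-set sparseness (the (ii)-side research content, NAMED).**  At coupling `β`, frame `w`, threshold `θ`, tolerated
extent `ℓ₀` (entering only through the guard) and base `q`: for all finite cell families `F ⊆ F'`, `F` nonempty, every exterior `ζ` meeting
the format's guard (each cell within sup-distance `1` of a cell of `F` is resampled, `∈ F'`, or `ζ ∈ TypChain ρ θ w ℓ₀ c'`), and every set `X`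
of plaquettes of the cells of `F`, the DLR kernel of the region `F'` gives `γ_{F'}(ζ){σ | ∀ p ∈ X, θ ≤ plaqAction ρ p σ} ≤ q ^ #X`.  Verbatim the
hypothesis `hsp` of `clauseIIukp_typChain_of_kernelSparse` (p540903).  NOT proved anywhere; see the module docstring for why it is not soft. -/
def KernelPlaqSparse {N : ℕ} (ρ : G →* Matrix (Fin N) (Fin N) ℂ) (β : ℝ) (w : Fin 4 → ℤ → ℤ) (θ : ℝ) (ℓ₀ : ℕ)
    (q : ℝ) : Prop :=
  ∀ F F' : Finset (Fin 4 → ℤ), F ⊆ F' → F.Nonempty → ∀ ζ : LGConfig 4 G,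
    (∀ c ∈ F, ∀ c' : Fin 4 → ℤ, (∀ i, |c' i - c i| ≤ 1) → c' ∈ F' ∨ ζ ∈ TypChain ρ θ w ℓ₀ c') →
      ∀ X : Finset (ZdPlaquette 4), X ⊆ F.biUnion (cellPlaqs w) →
        (ymSpecification ρ β (regionEdges w F') ζ) {σ : LGConfig 4 G | ∀ p ∈ X, θ ≤ plaqAction ρ p σ} ≤
          ENNReal.ofReal (q ^ X.card)

/-- `KernelPlaqSparse` is antitone in the base: a smaller base is a stronger statement. -/
theorem KernelPlaqSparse.mono {N : ℕ} {ρ : G →* Matrix (Fin N) (Fin N) ℂ} {β : ℝ} {w : Fin 4 → ℤ → ℤ} {θ : ℝ}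
    {ℓ₀ : ℕ} {q q' : ℝ} (hq0 : 0 ≤ q) (hqq' : q ≤ q') (h : KernelPlaqSparse ρ β w θ ℓ₀ q) :
    KernelPlaqSparse ρ β w θ ℓ₀ q' :=
  fun F F' hFF' hF ζ hguard X hX =>
    (h F F' hFF' hF ζ hguard X hX).trans (ENNReal.ofReal_le_ofReal (pow_le_pow_left₀ hq0 hqq' _))

/-- **Clause (ii) (UKP) for `TypChain` from NAMED kernel sparseness** — S1's `clauseIIukp_typChain_of_kernelSparse` with its hypothesis
`hsp` supplied by name. -/
theorem clauseIIukp_typChain_of_kernelPlaqSparse {N : ℕ} (ρ : G →* Matrix (Fin N) (Fin N) ℂ) (β : ℝ) {b : ℕ}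
    {w : Fin 4 → ℤ → ℤ} (hw : IsFrame b w) {θ : ℝ} {ℓ₀ : ℕ} {q δ : ℝ} (hq0 : 0 ≤ q) (hq : 3750 * q ≤ 1 / 2)
    (hδ : 192 * (b : ℝ) ^ 4 * q * (3750 * q) ^ ((ℓ₀ + 1) / 2) ≤ δ) (hK : KernelPlaqSparse ρ β w θ ℓ₀ q) :
    ClauseIIukp ρ β w δ (TypChain ρ θ w ℓ₀) :=
  clauseIIukp_typChain_of_kernelSparse ρ β hw θ ℓ₀ hq0 hq hδ hK

end KernelSparse

/-! ## §2 The Peierls budget arithmetic, once, for any rate `κ > 0` and mesh growth `C` -/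
section Budget

/-- The Peierls half-extent threshold for rate `κ` and mesh growth `C`: `⌈4 C⁺/κ⌉₊`. -/
def halfExtent (κ C : ℝ) : ℕ := ⌈4 * max C 0 / κ⌉₊

/-- **The explicit tolerated extent** served by the reduction: `2 · max ⌈48 C⁺/θ⌉₊ ⌈4 C⁺/κ⌉₊` (torus rate `θ/12`, kernel rate `κ`). -/
def extentOf (θ κ C : ℝ) : ℕ := 2 * max (halfExtent (θ / 12) C) (halfExtent κ C)

/-- The served extent dominates twice the torus half-extent (rate `θ/12`). -/
theorem two_mul_halfExtent_le_extentOf_left (θ κ C : ℝ) : 2 * halfExtent (θ / 12) C ≤ extentOf θ κ C :=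
  Nat.mul_le_mul_left _ (le_max_left _ _)

/-- The served extent dominates twice the kernel half-extent (rate `κ`). -/
theorem two_mul_halfExtent_le_extentOf_right (θ κ C : ℝ) : 2 * halfExtent κ C ≤ extentOf θ κ C :=
  Nat.mul_le_mul_left _ (le_max_right _ _)

/-- **Budget arithmetic.**  For a rate `κ > 0`, a mesh growth `C` and any `K₀ ≥ 4 C⁺/κ` (e.g. `K₀ = halfExtent κ C`): for every extent
`ℓ₀ ≥ 2 K₀`, every `δ > 0` and every prefactor `B` there is `β₂` such that for all `β ≥ β₂` and all meshes `b ≤ B e^{Cβ}` the base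
`q = e^{−κβ}` satisfies the two Peierls conditions `3750 q ≤ 1/2` and `192 b⁴ q (3750 q)^{⌈ℓ₀/2⌉} ≤ δ` (`⌈ℓ₀/2⌉ = (ℓ₀ + 1) / 2` in `ℕ`).
(The arithmetic inside S1's `exists_extent_clauseIII_typChain`, rate `κ = θ/12`, done once for every rate and monotone in the extent.) -/
theorem budget_of_halfExtent {κ : ℝ} (hκ : 0 < κ) (C : ℝ) {K₀ : ℕ} (hK₀ge : 4 * max C 0 / κ ≤ K₀) :
    ∀ ℓ₀ : ℕ, 2 * K₀ ≤ ℓ₀ → ∀ δ : ℝ, 0 < δ → ∀ B : ℝ, ∃ β₂ : ℝ, ∀ β : ℝ, β₂ ≤ β →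
      ∀ b : ℕ, (b : ℝ) ≤ B * Real.exp (C * β) →
        3750 * Real.exp (-(κ * β)) ≤ 1 / 2 ∧
          192 * (b : ℝ) ^ 4 * Real.exp (-(κ * β)) * (3750 * Real.exp (-(κ * β))) ^ ((ℓ₀ + 1) / 2) ≤ δ := by
  intro ℓ₀ hℓ₀ δ hδ B
  -- positive envelopes of the constants
  set C' : ℝ := max C 0 with hC'
  have hC'0 : 0 ≤ C' := le_max_right _ _
  set B' : ℝ := max B 1 with hB'
  have hB'0 : 0 ≤ B' := le_trans zero_le_one (le_max_right _ _)
  set M : ℝ := 192 * B' ^ 4 * 3750 ^ K₀ with hM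
  have hM0 : 0 < M := by positivity
  refine ⟨max 0 (max (Real.log 7500 / κ) (Real.log (M / δ) / κ)), fun β hβ b hbB => ?_⟩
  have hβ0 : 0 ≤ β := le_trans (le_max_left _ _) hβ
  have hβh : Real.log 7500 / κ ≤ β := le_trans (le_trans (le_max_left _ _) (le_max_right _ _)) hβ
  have hβM : Real.log (M / δ) / κ ≤ β := le_trans (le_trans (le_max_right _ _) (le_max_right _ _)) hβ
  set q : ℝ := Real.exp (-(κ * β)) with hq
  have hq0 : 0 < q := Real.exp_pos _
  -- `3750 q ≤ 1/2`
  have hhalf : 3750 * q ≤ 1 / 2 := by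
    have hκβ : Real.log 7500 ≤ κ * β := by
      have := (div_le_iff₀ hκ).1 hβh
      linarith [mul_comm β κ]
    have h1 : -(κ * β) ≤ Real.log (1 / 7500) := by
      rw [one_div, Real.log_inv]
      linarith
    have h2 : q ≤ 1 / 7500 := by
      rw [hq, ← Real.exp_log (by norm_num : (0 : ℝ) < 1 / 7500)]
      exact Real.exp_le_exp.2 h1
    linarith
  refine ⟨hhalf, ?_⟩
  -- monotonicity in the extent: `(3750 q)^{⌈ℓ₀/2⌉} ≤ (3750 q)^{K₀}`
  have hr0 : 0 ≤ 3750 * q := by positivity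
  have hr1 : 3750 * q ≤ 1 := by linarith
  have hKle : K₀ ≤ (ℓ₀ + 1) / 2 := by omega
  have hpow : (3750 * q) ^ ((ℓ₀ + 1) / 2) ≤ (3750 * q) ^ K₀ := pow_le_pow_of_le_one hr0 hr1 hKle
  -- `b ≤ B' e^{C' β}`
  have hbB' : (b : ℝ) ≤ B' * Real.exp (C' * β) := by
    refine hbB.trans ?_
    rcases le_or_gt B 0 with hB0 | hB0
    · exact le_trans (mul_nonpos_iff.2 (Or.inr ⟨hB0, (Real.exp_pos _).le⟩)) (by positivity)
    · exact mul_le_mul (le_max_left _ _)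
        (Real.exp_le_exp.2 (mul_le_mul_of_nonneg_right (le_max_left C 0) hβ0)) (Real.exp_pos _).le hB'0
  have hb0 : (0 : ℝ) ≤ b := Nat.cast_nonneg _
  have hb4 : (b : ℝ) ^ 4 ≤ B' ^ 4 * Real.exp (4 * C' * β) := by
    calc (b : ℝ) ^ 4 ≤ (B' * Real.exp (C' * β)) ^ 4 := pow_le_pow_left₀ hb0 hbB' 4
      _ = B' ^ 4 * Real.exp (4 * C' * β) := by
        rw [mul_pow, ← Real.exp_nat_mul]
        congr 2
        push_cast
        ring
  -- rate comparison: `e^{4C'β} q^{K₀+1} ≤ q` since `4 C'/κ ≤ K₀`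
  have hrate : Real.exp (4 * C' * β) * q ^ (K₀ + 1) ≤ q := by
    rw [hq, ← Real.exp_nat_mul, ← Real.exp_add]
    refine Real.exp_le_exp.2 ?_
    have h1 : 4 * C' ≤ (K₀ : ℝ) * κ := (div_le_iff₀ hκ).1 hK₀ge
    have h2 : 0 ≤ ((K₀ : ℝ) * κ - 4 * C') * β := mul_nonneg (by linarith) hβ0
    push_cast
    nlinarith
  -- `M q ≤ δ` from `β ≥ log (M/δ) / κ`
  have hMq : M * q ≤ δ := by
    have hκβ : Real.log (M / δ) ≤ κ * β := by
      have := (div_le_iff₀ hκ).1 hβM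
      linarith [mul_comm β κ]
    have h1 : -(κ * β) ≤ Real.log (δ / M) := by
      rw [Real.log_div hδ.ne' hM0.ne']
      rw [Real.log_div hM0.ne' hδ.ne'] at hκβ
      linarith
    have h2 : q ≤ δ / M := by
      rw [hq, ← Real.exp_log (div_pos hδ hM0)]
      exact Real.exp_le_exp.2 h1
    rwa [le_div_iff₀ hM0, mul_comm] at h2
  calc 192 * (b : ℝ) ^ 4 * q * (3750 * q) ^ ((ℓ₀ + 1) / 2)
      ≤ 192 * (b : ℝ) ^ 4 * q * (3750 * q) ^ K₀ := by gcongr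
    _ = 192 * 3750 ^ K₀ * (b : ℝ) ^ 4 * q ^ (K₀ + 1) := by ring
    _ ≤ 192 * 3750 ^ K₀ * (B' ^ 4 * Real.exp (4 * C' * β)) * q ^ (K₀ + 1) := by gcongr
    _ = M * (Real.exp (4 * C' * β) * q ^ (K₀ + 1)) := by rw [hM]; ring
    _ ≤ M * q := by gcongr
    _ ≤ δ := hMq

/-- `budget_of_halfExtent` at the canonical threshold `halfExtent κ C`. -/
theorem budget_of_extent {κ : ℝ} (hκ : 0 < κ) (C : ℝ) :
    ∀ ℓ₀ : ℕ, 2 * halfExtent κ C ≤ ℓ₀ → ∀ δ : ℝ, 0 < δ → ∀ B : ℝ, ∃ β₂ : ℝ, ∀ β : ℝ, β₂ ≤ β →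
      ∀ b : ℕ, (b : ℝ) ≤ B * Real.exp (C * β) →
        3750 * Real.exp (-(κ * β)) ≤ 1 / 2 ∧
          192 * (b : ℝ) ^ 4 * Real.exp (-(κ * β)) * (3750 * Real.exp (-(κ * β))) ^ ((ℓ₀ + 1) / 2) ≤ δ :=
  budget_of_halfExtent hκ C (Nat.le_ceil _)

end Budget

/-! ## §3 The REDUCED lane-A supplier targets and their composition to `TypChainSharpSC`, I♯_SC and `IR` -/
section Reduced

/-- **REDUCED lane-A supplier statement for the short-chain class (no clause (iii); clause (ii) in chessboard shape; EVERY extent).**  For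
every simply connected compact simple `G`, `r`, positive unit `a → 0` with `LowerBounds G r a`: admissible `(n, ε)`, a badness threshold
`θ > 0`, a kernel rate `κ > 0` and a mesh growth `C` such that FOR EVERY tolerated extent `ℓ₀` and every budget `δ > 0` there are `T, B, β₂`
with: for all `β ≥ β₂` SOME mesh `b ≥ 1` with `a β · b < T` and `b ≤ B e^{Cβ}` carries, on every mesh-`b` frame, clause (i) at every
centre for `TypChain r.ρ θ w ℓ₀` and kernel plaquette-set sparseness `KernelPlaqSparse r.ρ β w θ ℓ₀ (e^{−κβ})`. -/
def TypChainReducedSC : Prop :=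
  ∀ (G : Type) [Group G] [TopologicalSpace G] [IsTopologicalGroup G] [CompactSpace G],
    IsCompactSimpleLieGroup G → SimplyConnectedSpace G →
    letI : MeasurableSpace G := borel G; haveI : BorelSpace G := ⟨rfl⟩;
    ∀ (r : LatticeRep G) (a : ℝ → ℝ), (∀ β, 0 < a β) → Tendsto a atTop (𝓝 0) → LowerBounds G r a →
      ∃ (n : ℕ) (ε θ κ C : ℝ), 1 ≤ n ∧ 0 ≤ ε ∧ ε * OnsetFormats.shellCount n ≤ 3 / 4 ∧ 0 < θ ∧ 0 < κ ∧
        ∀ ℓ₀ : ℕ, ∀ δ : ℝ, 0 < δ → ∃ T B β₂ : ℝ, ∀ β : ℝ, β₂ ≤ β →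
          ∃ b : ℕ, 1 ≤ b ∧ a β * (b : ℝ) < T ∧ (b : ℝ) ≤ B * Real.exp (C * β) ∧
            ∀ w : Fin 4 → ℤ → ℤ, IsFrame b w →
              ClauseIAll r.ρ β w n ε (TypChain r.ρ θ w ℓ₀) ∧
                KernelPlaqSparse r.ρ β w θ ℓ₀ (Real.exp (-(κ * β)))

/-- **REDUCED lane-A supplier statement AT THE SINGLE EXTENT `extentOf θ κ C`** (the exact demand; weaker than `TypChainReducedSC`). -/
def TypChainReducedAtSC : Prop :=
  ∀ (G : Type) [Group G] [TopologicalSpace G] [IsTopologicalGroup G] [CompactSpace G],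
    IsCompactSimpleLieGroup G → SimplyConnectedSpace G →
    letI : MeasurableSpace G := borel G; haveI : BorelSpace G := ⟨rfl⟩;
    ∀ (r : LatticeRep G) (a : ℝ → ℝ), (∀ β, 0 < a β) → Tendsto a atTop (𝓝 0) → LowerBounds G r a →
      ∃ (n : ℕ) (ε θ κ C : ℝ), 1 ≤ n ∧ 0 ≤ ε ∧ ε * OnsetFormats.shellCount n ≤ 3 / 4 ∧ 0 < θ ∧ 0 < κ ∧
        ∀ δ : ℝ, 0 < δ → ∃ T B β₂ : ℝ, ∀ β : ℝ, β₂ ≤ β →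
          ∃ b : ℕ, 1 ≤ b ∧ a β * (b : ℝ) < T ∧ (b : ℝ) ≤ B * Real.exp (C * β) ∧
            ∀ w : Fin 4 → ℤ → ℤ, IsFrame b w →
              ClauseIAll r.ρ β w n ε (TypChain r.ρ θ w (extentOf θ κ C)) ∧
                KernelPlaqSparse r.ρ β w θ (extentOf θ κ C) (Real.exp (-(κ * β)))

/-- The every-extent statement serves the single extent. -/
theorem typChainReducedAtSC_of_reduced (h : TypChainReducedSC) : TypChainReducedAtSC := by
  intro G _ _ _ _ hG hsc
  letI : MeasurableSpace G := borel G
  haveI : BorelSpace G := ⟨rfl⟩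
  intro r a ha hat hlb
  obtain ⟨n, ε, θ, κ, C, hn, hε, hM, hθ, hκ, hsup⟩ := h G hG hsc r a ha hat hlb
  exact ⟨n, ε, θ, κ, C, hn, hε, hM, hθ, hκ, hsup (extentOf θ κ C)⟩

variable {G : Type} [Group G] [TopologicalSpace G] [IsTopologicalGroup G] [CompactSpace G]
  [MeasurableSpace G] [BorelSpace G]

/-- **Per-`(G, r)` engine of the reduction at the explicit extent `extentOf θ κ C`.**  For every `δ > 0` and `B` there is `β₂'` such that
for `β ≥ β₂'`, every mesh `1 ≤ b ≤ B e^{Cβ}` and every mesh-`b` frame `w`: kernel sparseness at base `e^{−κβ}` gives clause (ii), and the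
torus anchor (`clauseIII_typChain`) gives clause (iii), both with budget `δ`, for `TypChain r.ρ θ w (extentOf θ κ C)`. -/
theorem clauses_typChain_extentOf (r : LatticeRep G) {θ κ : ℝ} (hθ : 0 < θ) (hκ : 0 < κ) (C : ℝ) :
    ∀ δ : ℝ, 0 < δ → ∀ B : ℝ, ∃ β₂' : ℝ, ∀ β : ℝ, β₂' ≤ β →
      ∀ b : ℕ, 1 ≤ b → (b : ℝ) ≤ B * Real.exp (C * β) → ∀ w : Fin 4 → ℤ → ℤ, IsFrame b w →
        (KernelPlaqSparse r.ρ β w θ (extentOf θ κ C) (Real.exp (-(κ * β))) →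
            ClauseIIukp r.ρ β w δ (TypChain r.ρ θ w (extentOf θ κ C))) ∧
          ClauseIII r.ρ β w b δ (TypChain r.ρ θ w (extentOf θ κ C)) := by
  intro δ hδ B
  obtain ⟨β₁, hIII⟩ := clauseIII_typChain (G := G) r hθ
  obtain ⟨β₃, h₃⟩ := budget_of_extent (κ := θ / 12) (by positivity) C _
    (two_mul_halfExtent_le_extentOf_left θ κ C) δ hδ B
  obtain ⟨β₄, h₄⟩ := budget_of_extent hκ C _ (two_mul_halfExtent_le_extentOf_right θ κ C) δ hδ B
  refine ⟨max β₁ (max β₃ β₄), fun β hβ b hb1 hbB w hw => ?_⟩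
  have hβ1 : β₁ ≤ β := le_trans (le_max_left _ _) hβ
  have hβ3 : β₃ ≤ β := le_trans (le_trans (le_max_left _ _) (le_max_right _ _)) hβ
  have hβ4 : β₄ ≤ β := le_trans (le_trans (le_max_right _ _) (le_max_right _ _)) hβ
  obtain ⟨hhalf₃, hbud₃⟩ := h₃ β hβ3 b hbB
  obtain ⟨hhalf₄, hbud₄⟩ := h₄ β hβ4 b hbB
  exact ⟨fun hK => clauseIIukp_typChain_of_kernelPlaqSparse r.ρ β hw (Real.exp_pos _).le hhalf₄ hbud₄ hK,
    hIII β hβ1 b _ δ hb1 hhalf₃ hbud₃ w hw⟩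

/-- **`TypChainReducedAtSC ⇒ TypChainSharpSC` (PROVED).**  Per SC `(G, r, a)`: the supplier's `(n, ε, θ)` and `ℓ₀ = extentOf θ κ C`;
for each `δ` the later of the two `β₂`'s; (i) is the supplier's, (ii) from its kernel sparseness, (iii) from the torus anchor. -/
theorem typChainSharpSC_of_reducedAt (h : TypChainReducedAtSC) : TypChainSharpSC := by
  intro G _ _ _ _ hG hsc
  letI : MeasurableSpace G := borel G
  haveI : BorelSpace G := ⟨rfl⟩
  intro r a ha hat hlb
  obtain ⟨n, ε, θ, κ, C, hn, hε, hM, hθ, hκ, hsup⟩ := h G hG hsc r a ha hat hlb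
  refine ⟨n, ε, θ, extentOf θ κ C, hn, hε, hM, fun δ hδ => ?_⟩
  obtain ⟨T, B, β₂, hβ⟩ := hsup δ hδ
  obtain ⟨β₂', hβ'⟩ := clauses_typChain_extentOf (G := G) r hθ hκ C δ hδ B
  refine ⟨T, max β₂ β₂', fun β hb => ?_⟩
  obtain ⟨b, hb1, hlt, hbB, hw⟩ := hβ β (le_trans (le_max_left _ _) hb)
  refine ⟨b, hb1, hlt, fun w hwf => ?_⟩
  obtain ⟨hI, hK⟩ := hw w hwf
  obtain ⟨hII, hIII⟩ := hβ' β (le_trans (le_max_right _ _) hb) b hb1 hbB w hwf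
  exact ⟨hI, hII hK, hIII⟩

/-- **`TypChainReducedSC ⇒ TypChainSharpSC` (PROVED).** -/
theorem typChainSharpSC_of_reduced (h : TypChainReducedSC) : TypChainSharpSC :=
  typChainSharpSC_of_reducedAt (typChainReducedAtSC_of_reduced h)

/-- **`TypChainReducedAtSC ⇒` I♯_SC (PROVED).** -/
theorem onsetSharpUKPcSC_of_typChainReducedAtSC (h : TypChainReducedAtSC) : SharpOnset.OnsetSharpUKPcSC :=
  onsetSharpUKPcSC_of_typChainSharpSC (typChainSharpSC_of_reducedAt h)

/-- **`TypChainReducedSC ⇒` I♯_SC (PROVED).** -/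
theorem onsetSharpUKPcSC_of_typChainReducedSC (h : TypChainReducedSC) : SharpOnset.OnsetSharpUKPcSC :=
  onsetSharpUKPcSC_of_typChainSharpSC (typChainSharpSC_of_reduced h)

/-- **`TypChainReducedAtSC` ∧ residual ⇒ `BalabanLadder.IR` BY NAME (PROVED, E discharged, no X, no torus anchor).** -/
theorem ir_of_typChainReducedAtSC (h : TypChainReducedAtSC) (hN : SharpOnset.IRNSC) :
    Summit.QuantumFields.YangMills.Theses.BalabanLadder.IR :=
  ir_of_typChainSharpSC (typChainSharpSC_of_reducedAt h) hN

/-- **`TypChainReducedSC` ∧ residual ⇒ `BalabanLadder.IR` BY NAME (PROVED).** -/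
theorem ir_of_typChainReducedSC (h : TypChainReducedSC) (hN : SharpOnset.IRNSC) :
    Summit.QuantumFields.YangMills.Theses.BalabanLadder.IR :=
  ir_of_typChainSharpSC (typChainSharpSC_of_reduced h) hN

end Reduced

end Summit.QuantumFields.YangMills.Cruxes.IR.AfPincerUc.SharpLanes

end
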